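import Summits.QuantumFields.BalabanUV.T4Continuum.Spine.NE1p.DressedTowerWitnessTwoCubes
import Summits.QuantumFields.BalabanUV.T4Continuum.Spine.NE1p.DressedRootStrict

/-!
# T⁴ programme, spine estimate NE1′ (node O3b/H2) — A MET COMPONENT OF TWO CUBES, part 2 of 2: the scalars at `(v, mB, N₀, m) =
# (2, 1, 2, ⅛)`, the derived positional count ATTAINED at the birth scale, and the canonical terminal face S3l APPLIED to the two-cube
# tower at every integer `81 ≤ Lb ≤ 120` — With-form, headline, ROOT-B, and ROOT-C OF RECORD `DressedStabilityStrict towerD (Lb⁴)`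
# (swarm witness «W17», census slot (δ) of `t4/formal/NE1p/LEAVES.md` ∕ typer R-T65 (i); INTENT CLAIMS.log l.12373) [decided toy]

Cell `pub-balaban`, sub-cell `t4`, BINDER-OWNERS row NE1′ (owner lineage t4-ne1p-p1); formalisation crew
`b2b-balaban-t4-ne1p-formalise-*`, seat `…-leaf-01` (gen 6).  ADDITIVE — imports part 1 `Spine/NE1p/DressedTowerWitnessTwoCubes` (through it
leaf-02-g4's W11r part 1 `DressedTerminalWitnessReuse` p216180 — whose integer-window arithmetic is used BY NAME, nothing duplicated —,
S3l p215128, W7 p214558, S3c p213339) and the owner's `Spine/NE1p/DressedRootStrict` p216910 (ROOT-C OF RECORD, typer R-T65 (vii))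
ONLY; modifies nothing.  One design with part 1.
CREDIT.  The integer-window sizing («reuse W7's function-level data below `LW`; (w6)+(w7) ⟹ `81 ≤ L ≤ 120` at `s̄⁰ = 0`,
`m·N₀·A₀ = ¼`») is leaf-02-g4's (W11r) and leaf-07-g5's (S3c.1 «LF-4 EXACT» p216101); the transplant pattern is leaf-09-g4's (W14
p216469); ROOT-C of record and its door `dressedStabilityStrict_of_with` are the owner's (t4-ne1p-p1 g23, p216910), the product
identity `prod_cell` row S3's (leaf-09).

CONTENTS.
* §1 [arith] the scalars particular to `v = 2`: (w6) `hsmall_two : ⅛·(2·1·(1−¾)⁻¹) ≤ 1 − 0` (EQUALITY — `m·N₀·A₀ = ¼` as in W11r ∕ W14,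
  so LF-4's coupled threshold and the window `[81, 120]` are UNCHANGED), `hvN₀_two : 2·1 ≤ 2`, `hfan_two`, `hamp_two`; the fresh defect
  at the cell's rate `hδfD` (W7's `hδfM` then W11r's `psi_le_psiL`).
* §2 **the derived count with `N₀ = v·mB = 2`, attained** [decided toy]: `count_derived` = what the terminal face reads off part 1's
  anchoring through rows S4 ∕ S3i's `count_of_anchoring_cell` BY NAME (`#{live families of scale j at k} ≤ 2·(Lb⁴)^{k−j}`), and
  `count_attained`: at `k = j = 0` the left side IS `2 = 2·(Lb⁴)^0` — the volume factor `v = 2` of the count is used at full strength.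
* §3 **`dressedStabilityWith_towerD`**: for EVERY integer `81 ≤ Lb ≤ 120`, `DressedStabilityWith towerD 1 (rhoOne Lb⁻² 2 0 ½) Lb⁻³` by
  ONE application of S3l's `dressedStabilityWith_of_canonicalSliceWinSchedules` — its ≈ 50 `(a, K)`-indexed binder families inhabited
  AT ONCE by part 1 (anchoring at two blocks, housing in TWO cubes, the two-term dictionary, the booking convention) and W7's
  per-family lemmas BY NAME, with `(v, mB, N₀, m) = (2, 1, 2, ⅛)`; the headline **`dressedStability_towerD`**; ROOT-B
  **`dressedBudget_towerD`** by S3l's `dressedBudget_of_canonicalSliceWinSchedules` BY NAME (`1 ≤ v = 2`); **ROOT-C OF RECORD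
  `dressedStabilityStrict_towerD : DressedStabilityStrict towerD ((Lb:ℝ)^4)`** by the owner's `dressedStabilityStrict_of_with` with
  `r = ¾`: the strict product `Lb⁴·(3e³∕Lb²)·Lb⁻³ = locCell Lb 2 0 ½ ≤ ¾ < 1` IS (w7)'s located largeness (`prod_cell`, `hloc_int`) —
  at the rate `Λ = Lb⁴` of the face's own positional count (the pairing under which ROOT-C of record gives ROOT-B); `sizeBound_towerD`
  (END's consumer face); the decided instance `Lb = 100` and endpoint `example`s at `Lb = 81`, `Lb = 120`.

LIVE vs ≡ 0 (R-T56 (h) (2)).  LIVE by computation: positive sizes ∕ `lin` ∕ `gen` of both families at every `(K, k)`; the anchoring at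
two adjacent blocks straddling every block boundary (`center_fst_lt`), `mB = 1` by distinctness, housing in TWO cubes with `hhoused`
choosing the family's cube and NO one-cube housing (`not_housed_by_one_cube`), `#comp = 2` and `#S k b = 2` at every live scale, the
derived count ATTAINED at the birth scale; the two-term dictionary `hQ` (EQUATION) and the weighted two-point step law `hFn` (EQUATION,
W7's) for both families; fresh pairs for every live generation; `hcm` and (w6) `hsmall` with EQUALITY; the booking convention
(increment set bounded, `lin` attained); the absorption door and `hβ` at `K = 0` (EQUALITY).  DECLARED ≡ 0: `𝒜 ≡ 0` (`hB`∕`hE`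
constants — live in W9 ∕ W12), `s ≡ 0`, `creg ≡ 0` (live in W10), `Sabs ≡ ∅` (live in W13), `rel = Eq` (live in W15), `base ≡ 1`,
two-atom laws (W16), `z₀ = z₁ = 0`, `q ≡ 0`.

HONEST FRAMING.  A decided toy ([folklore]; 0 sorry; 0 citations; no `def`, no `def … : Prop`); NOTHING of Bałaban's localisation
domains, large-field met components, D-terms or windows is modelled or asserted; `Lb` is the cell's integer in `[81, 120]` and `Λ = Lb⁴`
the count rate OF THE TOY — kernel consequences of `locCell` ∕ (w6) ∕ `LW`, never «Bałaban's L» (k2); two adjacent unit blocks of a toy,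
NOT Bałaban's large-field components (k3-type caveat: no commutation identity, F-6's rate stays a displayed wall).  Headline (c4): «a met
component of TWO cubes is housed, counted (`N₀ = v·mB = 2`, attained) and budgeted: the canonical terminal face S3l FIRES on it at
every integer blocking factor 81 ≤ Lb ≤ 120 and ROOT-C OF RECORD `DressedStabilityStrict towerD (Lb⁴)` follows BY NAME; `hhoused` ∕
`hvol` ∕ `hvN₀` exercised with v = 2; non-vacuity of SHAPES only — NE1′ ⇐ the named binders, NOT proved, NOT printed; 0 binders
instantiated on Bałaban's densities»; spine PROVED 0∕9.  Rung (B)+1 on ONE finite four-torus — NOT infinite volume, NOT a mass gap,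
NOT OS on ℝ⁴, NOT Clay, NOT summit progress.  HONEST DEPENDENCY: continuum YM on T⁴ ⇐ BetaPertH ∧ nine spine estimates (0/9 proved);
BetaPertH ⇐ (D1) ∧ (D4) ∧ CAP+tail; G-an2-4 gates asym, D1 and NE2/3/4.
-/

noncomputable section

namespace Summit.QuantumFields.BalabanUV.T4Continuum.NE1p.DressedTowerWitnessTwoCubes

open MeasureTheory Set Metric Filter Finset
open scoped BigOperators
open Literature.MathematicalPhysics.QuantumFieldTheory.Balaban1983to89
open Literature.MathematicalPhysics.QuantumFieldTheory.Balaban1983to89.T4TermFormat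
open Literature.MathematicalPhysics.QuantumFieldTheory.Balaban1983to89.T4TermFormat.Booking
open Literature.MathematicalPhysics.QuantumFieldTheory.Balaban1983to89.T4FeltGeometry
open Literature.MathematicalPhysics.QuantumFieldTheory.Balaban1983to89.T4GatedBooking
open Literature.MathematicalPhysics.QuantumFieldTheory.Balaban1983to89.T4TrajectoryComparison
open T4TrajectoryModulus (bondBall bondBall_add_mem bondBall_latMove_add_mem bondBall_diam)
open T4BlockTransport (Fld NDir latMove latN Site norm_dir_le)
open T4BirthChartTransport (GaugeInvariant BirthSlice RelGauge)
open T4TrajectoryDensity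
open Summit.QuantumFields.BalabanUV.T4Continuum.T4TrajectoryDensityDressed
open Summit.QuantumFields.BalabanUV.T4Continuum.T4TrajectoryDensityWitness
open Summit.QuantumFields.BalabanUV.T4Continuum.NE1p.DressedRoot
open Summit.QuantumFields.BalabanUV.T4Continuum.NE1p.DressedUniformConstants
open Summit.QuantumFields.BalabanUV.T4Continuum.NE1p.DressedWindowScheduleWin
open Summit.QuantumFields.BalabanUV.T4Continuum.NE1p.DressedWindowScheduleModWin
open Summit.QuantumFields.BalabanUV.T4Continuum.NE1p.DressedTowerWitness
open Summit.QuantumFields.BalabanUV.T4Continuum.NE1p.DressedTowerWitnessSlice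
open Summit.QuantumFields.BalabanUV.T4Continuum.NE1p.DressedAbsorptionWindow
open Summit.QuantumFields.BalabanUV.T4Continuum.NE1p.DressedCellNecessity
open Summit.QuantumFields.BalabanUV.T4Continuum.NE1p.DressedStabilityOfSuppliedSchedules
open Summit.QuantumFields.BalabanUV.T4Continuum.NE1p.DressedStabilityOfCanonicalSliceWinSchedules
open Summit.QuantumFields.BalabanUV.T4Continuum.NE1p.DressedTerminalWitnessReuse

/-! ## §1 The scalars particular to `v = 2`, and the fresh defect at the cell's rate [arith] -/

/-- (w6) window at `(m, N₀, A₀, ρ′, s̄⁰) = (⅛, 2, 1, ¾, 0)`, with EQUALITY: `⅛·(2·1·4) = 1 ≤ 1 − 0` — halving the source factor pays for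
the doubled count multiplicity `N₀ = v·mB = 2`, so `m·N₀·A₀ = ¼` exactly as in W11r ∕ W14 and LF-4's window is unchanged. [folklore] -/
theorem hsmall_two : (1 / 8 : ℝ) * (2 * 1 * (1 - 3 / 4)⁻¹) ≤ 1 - 0 := by norm_num

/-- [arith] [folklore] `v·mB = 2·1 ≤ N₀ = 2` — the volume enters the count multiplicity. -/
theorem hvN₀_two : ((2 : ℕ) : ℝ) * ((1 : ℕ) : ℝ) ≤ 2 := by norm_num

/-- [arith] [folklore] No absorption, no fan-out at `N₀ = 2`: `fanout 0 2 ¾ = 0 < 1`. -/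
theorem hfan_two : fanout 0 2 (3 / 4) < 1 := by norm_num [fanout]

/-- [arith] [folklore] The absorption fixed point at `N₀ = 2`: `absorbAmplitude 1 0 2 ¾ = 1 ≤ A₀ = 1`. -/
theorem hamp_two : absorbAmplitude 1 0 2 (3 / 4) ≤ 1 := by norm_num [absorbAmplitude, fanout]

/-- `hδf` (I4′) AT THE CELL's RATE, for every live generation of the two-family component [decided toy]: W7's fresh defect
`ψ_W^{k+1}∕4 ≤ ½·ψ_W^{k}` (`hδfM`) `≤ ½·(Lb⁻²)^{k}` (W11r's `psi_le_psiL`; every live generation has scale `0`). [folklore] -/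
theorem hδfD {Lb : ℕ} (h81 : 81 ≤ Lb) (h120 : Lb ≤ 120) (K : ℕ) :
    ∀ (k : ℕ) (b : Fin 2), ∀ p ∈ SgD K k b, 0 ≤ dfW k ∧ dfW k ≤ 1 / 2 * (((Lb : ℝ) ^ 2)⁻¹) ^ (k - p.2) := by
  intro k b p hp
  obtain ⟨_, h2⟩ := mem_SgD hp
  rw [h2]
  have h := hδfM K k () ((), 0) (Finset.mem_singleton_self _)
  exact ⟨h.1, h.2.trans (mul_le_mul_of_nonneg_left (pow_le_pow_left₀ psi_pos.le (psi_le_psiL h81 h120) _) (by norm_num))⟩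

/-! ## §2 The positional count the terminal face derives from the anchoring, with `N₀ = 2` — and its attainment [decided toy] -/

/-- **THE DERIVED COUNT** [bookkeeping on the toy]: what the terminal face reads off part 1's anchoring through rows S4 ∕ S3i's
`count_of_anchoring_cell` BY NAME — the live families of the met component are born (`hS`) and positionally counted by
`2·(Lb⁴)^{k−j}` (`hcount`, `N₀ = v·mB = 2·1`, `Λ = Lb⁴`).  Nothing is supplied by hand. [folklore] -/
theorem count_derived (K : ℕ) {Lb : ℕ} (hLb : 1 ≤ Lb) :
    (∀ k b, ∀ f ∈ SD K k b, (BD K).birthScale f ≤ k) ∧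
      ∀ k b, ∀ j ≤ k, (((SD K k b).filter fun f => (BD K).birthScale f = j).card : ℝ) ≤ 2 * ((Lb : ℝ) ^ 4) ^ (k - j) :=
  count_of_anchoring_cell (anchD K Lb) rfl (by exact_mod_cast hLb) (hmultD K Lb) (hscaleD K) (hhousedD K) (hvolD K) (by norm_num)

/-- **THE DERIVED COUNT IS ATTAINED AT THE BIRTH SCALE** [decided toy]: at `k = j = 0` the met component carries BOTH families of birth
scale `0`, and `2 = 2·(Lb⁴)^{0}` — the count multiplicity `N₀ = v·mB = 2` holds with EQUALITY on the toy (every cutoff). [folklore] -/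
theorem count_attained (K : ℕ) (Lb : ℕ) (b : Fin 2) :
    (((SD K 0 b).filter fun f => (BD K).birthScale f = 0).card : ℝ) = 2 * ((Lb : ℝ) ^ 4) ^ (0 - 0) := by
  have h1 : ((SD K 0 b).filter fun f => (BD K).birthScale f = 0) = SD K 0 b := Finset.filter_true_of_mem fun _ _ => rfl
  have h2 : ((SD K 0 b).filter fun f => (BD K).birthScale f = 0).card = 2 :=
    (congrArg Finset.card h1).trans (liveFamilies_card (Nat.zero_le K) b)
  have h3 : (((SD K 0 b).filter fun f => (BD K).birthScale f = 0).card : ℝ) = 2 := by exact_mod_cast h2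
  rw [h3]; norm_num

/-! ## §3 THE TERMINAL FACE FIRES on the two-cube tower at every integer of the window; ROOT-C OF RECORD [decided toy] -/

/-- **A MET COMPONENT OF TWO CUBES IS HOUSED, COUNTED AND BUDGETED — S3l's `dressedStabilityWith_of_canonicalSliceWinSchedules` APPLIED
TO THE TWO-CUBE TOWER AT EVERY INTEGER BLOCKING FACTOR `81 ≤ Lb ≤ 120`** [decided toy]: the canonical terminal face's ≈ 50
`(a, K)`-indexed binder families — (w1) `hsl`, H2 `hFn`∕`h𝒢`∕`hQ`∕`hSg`∕`hmeas`, (w2-act) `hB`∕`hE`∕`hs₀`, (I4′)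
`hδf`∕`hδfwk`∕`hpairx`∕`hdefwk`∕`hrate` + `hcm`, F-9 `hinv`∕`hDμ`∕`hz₁`, the booking convention `hne`∕`hsup`, (w5) `hc0`∕`hcb`∕`hreg`,
the anchoring DATA `Anch := anchD K Lb` (two adjacent blocks) ∕ `hLb := rfl` ∕ `hmult` ∕ `hscale` ∕ **`hhoused` (the family's own cube
among the component's TWO) ∕ `hvol` (`≤ 2`, attained)**, the absorption DATA `holder`∕`hsub`∕`habs`∕`hβ`, ONE cutoff-free schedule `Wm`
(ratio `κ = ½`), and the located scalars `(κ, L, c̄, N₀, A₀, s̄⁰, ρ′, r, c_δ, m, v, mB, A, β₀) = (½, Lb, 0, 2, 1, 0, ¾, 1, ½, ⅛, 2, 1,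
0, 1)` bound ONCE (**`hvN₀ : 2·1 ≤ 2`**) — inhabited AT ONCE; conclusion: class amplitude `1`, family factor
`rhoOne Lb⁻² 2 0 ½ = 3e³∕Lb²`, source decay `Lb⁻³`.  Non-vacuity of binder SHAPES; nothing of Bałaban's densities; NE1′ NOT proved.
[folklore] -/
theorem dressedStabilityWith_towerD {Lb : ℕ} (h81 : 81 ≤ Lb) (h120 : Lb ≤ 120) :
    DressedStabilityWith towerD 1 (rhoOne ((Lb : ℝ) ^ 2)⁻¹ (4 * (1 / 2) / 1) 0 (1 / 2)) ((Lb : ℝ)⁻¹ ^ 3) :=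
  dressedStabilityWith_of_canonicalSliceWinSchedules towerD (κ := 1 / 2) (L := (Lb : ℝ)) (cbar := 0) (N₀ := 2) (A₀ := 1)
    (sbar := 0) (ρ' := 3 / 4) (r := 1) (cδ := 1 / 2) (m := 1 / 8) (w := fun _ _ => 1) (fun _ _ => Wm) (by norm_num)
    (Fn := fun _ K _ k' k => FnM K k' k) (rel := fun _ _ _ _ _ U U' => U = U') (ref := fun _ _ _ _ U => U)
    (base := fun _ _ _ _ => base₁) (𝒜 := fun _ _ _ _ => zeroExp) (𝒬 := fun _ K _ k => 𝒬T K k) (q := fun _ _ _ _ _ => 0)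
    (μ := fun _ _ _ k => flAt (atomW (k + 1))) (z₀ := fun _ _ _ _ => 0) (z₁ := fun _ _ _ _ => 0)
    (defect := fun _ _ _ _ k => defW (k + 1)) (s := fun _ _ _ _ => 0) (S := fun _ K k b => SD K k b)
    (Sg := fun _ K k b => SgD K k b) (c := fun _ _ _ _ => ((1 / 8 : ℝ) : ℂ)) (δf := fun _ _ _ k _ => dfW k)
    (creg := fun _ _ _ => 0) (mB := 1) (v := 2) (fun _ K => anchD K Lb) (comp := fun _ K k b => compD K k b)
    (Sabs := fun _ _ _ => ∅) (β := fun _ K _ => (LW⁻¹ ^ 3) ^ K) (A := 0) (β₀ := 1)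
    (fun _ _ => hratioM) (one_le_natL h81) le_rfl (by norm_num) zero_le_one (by norm_num) (hloc_int h81) hρ'_int hsmall_two
    one_pos (by norm_num)
    (fun _ K b k' _ _ _ => birthSlice_anti_window (hslD K b k') (Wm.hwcw k'))
    (fun _ K _ k' k _ _ hk _ U => hFnT K k' k hk U) (fun _ _ _ _ k _ _ _ _ _ => mem_bddClass_flAt _ _)
    (fun _ _ _ _ k _ _ _ _ => realBaseAt_W _ _) (fun _ _ _ _ k _ _ _ _ => exponentSliceAt_M _ _ _ _)
    (fun _ K b k x hx => hδfD h81 h120 K k b x hx) (fun _ _ _ k => hDμM k) (fun _ _ _ k => hz₁M k)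
    (fun _ _ _ _ k _ _ _ _ U₀ _ pd _ _ => (relGauge_pairs k).mono fun z hz t _ => hz (latMove U₀ pd t))
    (fun _ _ _ _ _ _ _ h => h ▸ rfl) (fun _ _ _ _ _ k _ => aesm_flAt _ _) (fun _ _ _ _ k => hdefwkM k)
    (fun _ _ _ k' k _ _ _ => hrateT h81 h120 k' k) (fun _ _ _ _ k _ _ _ _ => hneM k)
    (fun _ K b k' k _ _ _ _ => hsupD K b k' k) (fun _ _ _ => le_rfl) (fun _ _ _ _ => le_rfl) (fun _ K => hregD K _)
    (fun _ _ _ _ => le_rfl) rfl (fun _ K => hmultD K Lb) (fun _ K => hscaleD K) (fun _ K => hhousedD K)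
    (fun _ K => hvolD K) (fun _ _ _ _ h => absurd h (Finset.notMem_empty _)) (fun _ _ _ => Finset.empty_subset _)
    (fun _ K => habsD K _ _) (fun _ K j _ => tau_pow_le h81 h120 K j) (fun _ K b k => hQD K b k) (fun _ K => hSgD K)
    (fun _ _ _ _ => hcmD) (fun _ _ _ k _ _ => hδfwkM k) hvN₀_two le_rfl hfan_two hamp_two

/-- **THE HEADLINE `DressedStability towerD` OUT OF THE CANONICAL TERMINAL FACE** [decided toy], at every integer of the window (the
face's existential form is this packaging of the With-form; a COROLLARY of the root of record below). [folklore] -/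
theorem dressedStability_towerD {Lb : ℕ} (h81 : 81 ≤ Lb) (h120 : Lb ≤ 120) : DressedStability towerD :=
  ⟨_, _, _, dressedStabilityWith_towerD h81 h120⟩

/-- [decided toy] END's consumer face at every cutoff: every booked size of both families is below the two-rate profile
`twoRate 1 (3e³∕Lb²) Lb⁻³ K`. [folklore] -/
theorem sizeBound_towerD {Lb : ℕ} (h81 : 81 ≤ Lb) (h120 : Lb ≤ 120) (p : Unit) (K : ℕ) :
    (towerD.B p K).SizeBound
      (twoRate 1 (rhoOne ((Lb : ℝ) ^ 2)⁻¹ (4 * (1 / 2) / 1) 0 (1 / 2)) ((Lb : ℝ)⁻¹ ^ 3) (towerD.B p K).K) :=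
  sizeBound_of_dressedStabilityWith (dressedStabilityWith_towerD h81 h120) p K

/-- **ROOT-C OF RECORD OUT OF THE CANONICAL TERMINAL FACE — `DressedStabilityStrict towerD (Lb⁴)`** [decided toy] (typer R-T65 (vii);
owner's `DressedRootStrict` p216910): the With-form at the displayed constants feeds the owner's door `dressedStabilityStrict_of_with`
with `r = ¾`, the strict product `Lb⁴·rhoOne(Lb⁻²,2,0,½)·Lb⁻³ = locCell Lb 2 0 ½` (row S3's `prod_cell`) being (w7)'s located
largeness `≤ ¾ < 1` (W11r's `hloc_int`) — AT THE RATE `Λ = Lb⁴` OF THE FACE's OWN POSITIONAL COUNT (`count_derived`), the pairing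
under which ROOT-C of record gives ROOT-B (`dressedBudget_of_dressedStabilityStrict`). [folklore] -/
theorem dressedStabilityStrict_towerD {Lb : ℕ} (h81 : 81 ≤ Lb) (h120 : Lb ≤ 120) :
    DressedStabilityStrict towerD ((Lb : ℝ) ^ 4) :=
  dressedStabilityStrict_of_with (r := 3 / 4) (dressedStabilityWith_towerD h81 h120) (by positivity)
    (by rw [prod_cell (natL_pos h81)]; exact hloc_int h81) hρ'_int

/-- **ROOT-B OUT OF THE CANONICAL TERMINAL FACE** [decided toy]: for every run-weight family `0 ≤ wt () K j ≤ w̄` and every integer of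
the window, `DressedBudget towerD wt` by S3l's `dressedBudget_of_canonicalSliceWinSchedules` BY NAME — the SAME two-block anchoring read
as the bookings' positional count with volume `v = 2 ≥ 1`, the whole binder list inhabited at once. [folklore] -/
theorem dressedBudget_towerD {Lb : ℕ} (h81 : 81 ≤ Lb) (h120 : Lb ≤ 120) {wbar : ℝ} {wt : Unit → ℕ → ℕ → ℝ}
    (hwbar : 0 ≤ wbar) (hw0 : ∀ p K, ∀ j ≤ K, 0 ≤ wt p K j) (hwb : ∀ p K, ∀ j ≤ K, wt p K j ≤ wbar) :
    DressedBudget towerD wt :=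
  dressedBudget_of_canonicalSliceWinSchedules towerD (κ := 1 / 2) (L := (Lb : ℝ)) (cbar := 0) (N₀ := 2) (A₀ := 1)
    (sbar := 0) (ρ' := 3 / 4) (r := 1) (cδ := 1 / 2) (m := 1 / 8) (w := fun _ _ => 1) (fun _ _ => Wm) (by norm_num)
    (Fn := fun _ K _ k' k => FnM K k' k) (rel := fun _ _ _ _ _ U U' => U = U') (ref := fun _ _ _ _ U => U)
    (base := fun _ _ _ _ => base₁) (𝒜 := fun _ _ _ _ => zeroExp) (𝒬 := fun _ K _ k => 𝒬T K k) (q := fun _ _ _ _ _ => 0)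
    (μ := fun _ _ _ k => flAt (atomW (k + 1))) (z₀ := fun _ _ _ _ => 0) (z₁ := fun _ _ _ _ => 0)
    (defect := fun _ _ _ _ k => defW (k + 1)) (s := fun _ _ _ _ => 0) (S := fun _ K k b => SD K k b)
    (Sg := fun _ K k b => SgD K k b) (c := fun _ _ _ _ => ((1 / 8 : ℝ) : ℂ)) (δf := fun _ _ _ k _ => dfW k)
    (creg := fun _ _ _ => 0) (mB := 1) (v := 2) (fun _ K => anchD K Lb) (comp := fun _ K k b => compD K k b)
    (Sabs := fun _ _ _ => ∅) (β := fun _ K _ => (LW⁻¹ ^ 3) ^ K) (A := 0) (β₀ := 1)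
    (fun _ _ => hratioM) (one_le_natL h81) le_rfl (by norm_num) zero_le_one (by norm_num) (hloc_int h81) hρ'_int hsmall_two
    one_pos (by norm_num)
    (fun _ K b k' _ _ _ => birthSlice_anti_window (hslD K b k') (Wm.hwcw k'))
    (fun _ K _ k' k _ _ hk _ U => hFnT K k' k hk U) (fun _ _ _ _ k _ _ _ _ _ => mem_bddClass_flAt _ _)
    (fun _ _ _ _ k _ _ _ _ => realBaseAt_W _ _) (fun _ _ _ _ k _ _ _ _ => exponentSliceAt_M _ _ _ _)
    (fun _ K b k x hx => hδfD h81 h120 K k b x hx) (fun _ _ _ k => hDμM k) (fun _ _ _ k => hz₁M k)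
    (fun _ _ _ _ k _ _ _ _ U₀ _ pd _ _ => (relGauge_pairs k).mono fun z hz t _ => hz (latMove U₀ pd t))
    (fun _ _ _ _ _ _ _ h => h ▸ rfl) (fun _ _ _ _ _ k _ => aesm_flAt _ _) (fun _ _ _ _ k => hdefwkM k)
    (fun _ _ _ k' k _ _ _ => hrateT h81 h120 k' k) (fun _ _ _ _ k _ _ _ _ => hneM k)
    (fun _ K b k' k _ _ _ _ => hsupD K b k' k) (fun _ _ _ => le_rfl) (fun _ _ _ _ => le_rfl) (fun _ K => hregD K _)
    (fun _ _ _ _ => le_rfl) rfl (fun _ K => hmultD K Lb) (fun _ K => hscaleD K) (fun _ K => hhousedD K)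
    (fun _ K => hvolD K) (fun _ _ _ _ h => absurd h (Finset.notMem_empty _)) (fun _ _ _ => Finset.empty_subset _)
    (fun _ K => habsD K _ _) (fun _ K j _ => tau_pow_le h81 h120 K j) (fun _ K b k => hQD K b k) (fun _ K => hSgD K)
    (fun _ _ _ _ => hcmD) (fun _ _ _ k _ _ => hδfwkM k) hvN₀_two le_rfl hfan_two hamp_two hwbar hw0 hwb (by norm_num)

/-- **ROOT-B FROM ROOT-C OF RECORD, THE OWNER's WAY** [decided toy]: the strict root at `Λ = Lb⁴` and the positional count the face
derives at the SAME rate (`count_derived`, here read as the bookings' count through the anchoring) give `DressedBudget` by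
`dressedBudget_of_dressedStabilityStrict` BY NAME — shown at unit weights. [folklore] -/
theorem dressedBudget_towerD_of_strict {Lb : ℕ} (h81 : 81 ≤ Lb) (h120 : Lb ≤ 120) :
    DressedBudget towerD (fun _ _ _ => (1 : ℝ)) :=
  dressedBudget_of_dressedStabilityStrict (N₀ := ((1 : ℕ) : ℝ)) (wbar := 1) (dressedStabilityStrict_towerD h81 h120)
    (by norm_num) zero_le_one (fun _ _ _ _ => zero_le_one) (fun _ _ _ _ => le_rfl) fun _ K =>
    (anchD K Lb).positionalCount_of_anchoring (lt_of_lt_of_le (by norm_num) h81) (hmultD K Lb)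

/-- [decided toy] THE DECIDED INSTANCE `Lb = 100`: ROOT-C of record `DressedStabilityStrict towerD (100⁴)` — the two-cube tower's terms
lie in the class `(1, 3e³∕10⁴, 10⁻⁶)` with strict product `3e³∕100 ≤ ¾` against the count rate `10⁸`. [folklore] -/
theorem dressedStabilityStrict_towerD_hundred : DressedStabilityStrict towerD ((100 : ℝ) ^ 4) := by
  simpa using dressedStabilityStrict_towerD (Lb := 100) (by norm_num) (by norm_num)

/-- [decided toy] The closed budget instance at the least integer of the window: unit run weights. [folklore] -/
example : DressedBudget towerD fun _ _ _ => 1 :=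
  dressedBudget_towerD (Lb := 81) le_rfl (by norm_num) (wbar := 1) zero_le_one (fun _ _ _ _ => zero_le_one)
    fun _ _ _ _ => le_rfl

/-- [decided toy] The window is inhabited at both ends: the terminal face fires with blocking integer `81` … [folklore] -/
example : DressedStabilityStrict towerD ((81 : ℝ) ^ 4) := by
  simpa using dressedStabilityStrict_towerD (Lb := 81) le_rfl (by norm_num)

/-- [decided toy] … and with blocking integer `120`; the headline follows from the root of record (`dressedStability_of_strict`). [folklore] -/
example : DressedStability towerD :=
  dressedStability_of_strict (dressedStabilityStrict_towerD (Lb := 120) (by norm_num) le_rfl)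

end Summit.QuantumFields.BalabanUV.T4Continuum.NE1p.DressedTowerWitnessTwoCubes

end
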